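import Literature.NumberTheory.PAdicHodge.BmaxPlusTDivisibilityAllPrimes
import Literature.NumberTheory.PAdicHodge.BmaxPlusBdRModFilPeriods
import Literature.NumberTheory.PAdicHodge.BmaxPlusBdRModFilRing
import Literature.NumberTheory.PAdicHodge.BmaxPlusBdRModFilLog
import Literature.NumberTheory.PAdicHodge.BmaxPlusBdRModFilTheta
import Literature.NumberTheory.PAdicHodge.BmaxPlusLogSeriesFrobenius
import HarnessLib

/-!
# `(A_max)^{φ=p} ⊆ ℚ_p · X⁰_k`: every Frobenius eigenvector of `A_max` is a `ℚ_p`-combination of Teichmüller logarithms modulo `Fil^k`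

Topic `Literature/NumberTheory/PAdicHodge`; namespace `Literature.NumberTheory.PAdicHodge`. THEOREMS ONLY (no definition, no named
fact, no instance, no `sorry`). The fragment of Fontaine's fundamental exact sequence needed by the socket of line `kato_lever`
(`Cruxes/StarredOptimalManinUnitFiveSeven/Lines/kato-lever-K3-legendre.md` §7.3 (iii)): the passage from the `φ`-road's currency
«`φx = px` in `A_max`» to the socket's currency «`X⁰_k = log[1 + p♭𝒪♭] mod Fil^k`» (`IsTeichLog`, `BdRPlusLogTeich`).

* `exists_logSum_teichmuller` — for `x ∈ 𝒪♭` with `x₀ = 1`, the `A_max`-element `Λ = Λ^{log}_1([x] − 1) = p·log[x]` (edix-p4,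
  `frobBmaxPlus_logSum_teichmuller_sub_one`: `φΛ = pΛ`), its comparison limit `L_Λ = p·L'` with `IsLogModFil k ([x]−1) L'` (g24, `BmaxPlusBdRModFilLogType`)
  and `θ_max(Λ) = θ_dR(L_Λ)`.
* ★★★ `isTeichLog_pow_mul_of_bdR_lim_modFil_of_frobBmaxPlus_eq` — **if `φ(x) = p·x` in `A_max` and `L ∈ B_dR⁺` is a comparison limit of `x`
  modulo `Fil^k` (`k ≥ 1`, `BmaxPlusBdRModFil.exists_bdR_lim_modFil`), then `IsTeichLog k (p^M·L)` for some `M`**: choose a Teichmüller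
  logarithm `L₁ = log[x₁]` with `θ(L₁) = p^{N}θ(x)` (IMAGE, `BdRPlusLogTeich`); the `A_max`-lift `Λ` of `p·log[x₁]` has `θ(p^{N+1}x − Λ) = 0`, so
  FONTAINE'S LEMMA (`BmaxPlusTDivisibilityAllPrimes`) gives `p²(p^{N+1}x − Λ) = λ·t`, and the comparison (a ring map sending `t ↦ t`) yields
  `p^{N+3}L ≡ p³L' + λt (mod ξ^k)`.

So `(B_max⁺)^{φ=p} → B_dR⁺/Fil^k` lands in `ℚ_p·X⁰_k` — Fontaine's `(B_cris⁺)^{φ=p} = ℚ_p ⊗ log[1+𝔪♭]` read modulo `Fil^k`, proved here without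
`B_cris`. With this the φ-road of line `kato_lever` (crux K★ `stmt-BirchSwinnertonDyer-22226`, memos `kato-lever-K2-phi-road.md`, `kato-lever-K2-tdiv-g25.md`)
lacks only the division-tower instantiation (M) and the B8 assembly. Infrastructure only: BSD / K★ are not proved by any of this.

## References
* [FontaineAsterisque223III] J.-M. Fontaine, *Le corps des périodes p-adiques*, Astérisque 223 (1994), Exp. III Th. 5.3.7.
* [FontaineOuyang2022] J.-M. Fontaine, Y. Ouyang, *Theory of p-adic Galois representations*, §6.1 (Thm. 6.26, `U → B_crys^{φ=p}`).
* [Colmez1998Annals] P. Colmez, *Théorie d'Iwasawa des représentations de de Rham d'un corps local*, Ann. of Math. 148 (1998), §III.3.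
-/

noncomputable section

open WittVector Field ValuativeRel Polynomial Finset
open Literature.AlgebraicGeometry.Resolution

namespace Literature.NumberTheory.PAdicHodge

open Literature.NumberTheory.GaloisRepresentations
open Literature.NumberTheory.GaloisRepresentations.IsNonarchimedeanLocalField
open GaloisContinuity
open Literature.RingTheory.FormalGroups

variable {F : Type} [Field F] [ValuativeRel F] [TopologicalSpace F] [IsNonarchimedeanLocalField F]
  [CharZero F] {p : ℕ} [Fact p.Prime] [Fact (¬ IsUnit (p : integerC F))]
  [IsAdicComplete (Ideal.span {(p : integerC F)}) (integerC F)]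

/-! ### The `A_max`-lift `Λ = p·log[x]` of a Teichmüller logarithm and its comparison limit -/

set_option maxHeartbeats 3200000 in
set_option synthInstance.maxHeartbeats 400000 in
/-- **The `A_max`-element `Λ = p·log[x]` (`x₀ = 1`)**: a `φ = p` eigenvector of `A_max` together with a comparison limit `L_Λ = p·L'` modulo
`Fil^k`, where `L'` is THE Teichmüller logarithm of `[x]` modulo `Fil^k` (`IsLogModFil k ([x] − 1) L'`), and `θ_dR(L_Λ) = θ_max(Λ)` (`k ≥ 1`).
[cite: FontaineOuyang2022, §6.1] [cite: Colmez1998Annals, §III.3] -/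
theorem exists_logSum_teichmuller (x : PreTilt (integerC F) p) (hx : PreTilt.coeff 0 x = 1) {k : ℕ} (hk : 1 ≤ k) :
    ∃ (Λ : BmaxPlus F p) (LΛ L' : BDeRhamPlus (integerC F) p) (r : ℕ),
      frobBmaxPlus F p Λ = (p : BmaxPlus F p) * Λ ∧
      (∀ N M : ℕ, N + r ≤ M → ∀ y : bmaxZero F p,
      AdicCompletion.evalₐ (Ideal.span {(p : bmaxZero F p)}) M (Λ) = Ideal.Quotient.mk _ y →
      ∃ (a : Ainf (p := p) F) (w : BDeRhamPlus (integerC F) p),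
        (p : BDeRhamPlus (integerC F) p) ^ k *
            (LΛ - algebraMap (Localization.Away (p : Ainf (p := p) F)) (BDeRhamPlus (integerC F) p)
              (y : Localization.Away (p : Ainf (p := p) F))) =
          ainfToBdR ((p : Ainf (p := p) F) ^ N * a) + xiBdR ^ k * w) ∧
      (p : BDeRhamPlus (integerC F) p) * L' = LΛ ∧
      IsLogModFil k ((teichmuller p x : Ainf (p := p) F) - 1) L' ∧
      thetaBdR LΛ = ((thetaBmaxPlus F p Λ : integerC F) : CompletedAlgClosure F) := by
  have hy : ((teichmuller p x : Ainf (p := p) F) - 1) ^ 1 ∈ Ideal.span {(p : Ainf (p := p) F), xi} := by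
    rw [pow_one]; exact (teichmuller_sub_one_mem_span_p_xi_iff_coeff_zero x).2 hx
  obtain ⟨z, hz⟩ := exists_algebraMap_pow_eq_natCast_mul hy
  set Λ : BmaxPlus F p := PadicLogSeries.logSum ((algebraMap (Ainf (p := p) F) (bmaxZero F p)).comp zpToAinf)
    (fun m => if m = 0 then 0 else (-1) ^ (m + 1)) 1
    (algebraMap (Ainf (p := p) F) (bmaxZero F p) ((teichmuller p x : Ainf (p := p) F) - 1)) z with hΛ
  have hφ : frobBmaxPlus F p Λ = (p : BmaxPlus F p) * Λ := frobBmaxPlus_logSum_teichmuller_sub_one x le_rfl hz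
  obtain ⟨LΛ, r, hL⟩ := exists_bdR_lim_modFil Λ k
  obtain ⟨L', hpL', hL'⟩ := exists_isLogTypeModFil_of_bdR_lim_modFil_logSum (fun m => if m = 0 then 0 else (-1) ^ (m + 1)) le_rfl _ hz hL
  have hL'' : IsLogModFil k ((teichmuller p x : Ainf (p := p) F) - 1) L' := by
    rw [← isLogTypeModFil_neg_one_pow_iff]
    exact isLogTypeModFil_congr (fun m hm => by rw [if_neg hm]) hL'
  refine ⟨Λ, LΛ, L', r, hφ, hL, ?_, hL'', thetaBdR_eq_of_bdR_lim_modFil hk hL⟩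
  rw [pow_one] at hpL'
  exact hpL'

/-! ### The fragment of the fundamental exact sequence -/

set_option maxHeartbeats 3200000 in
set_option synthInstance.maxHeartbeats 400000 in
/-- ★★★ **`(A_max)^{φ=p} ⊆ ℚ_p·X⁰_k` modulo `Fil^k`.** Let `x ∈ A_max = B_max⁺(F)` with `φ(x) = p·x`, `k ≥ 1`, and let `L ∈ B_dR⁺(F)` be a
comparison limit of `x` modulo `Fil^k` (`BmaxPlusBdRModFil.exists_bdR_lim_modFil`, any shift `r`). Then **`p^M·L` is a Teichmüller logarithm
modulo `Fil^k`** for some `M` (`IsTeichLog k (p^M L)`; indeed `p^{N+3}L ≡ p³·log[x₁] + λ·t` with `x₁ ∈ 1 + p♭𝒪♭`, `λ ∈ ℤ_p`). Fontaine's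
`(B_cris⁺)^{φ=p} ⊆ ℚ_p ⊗ log[1 + 𝔪♭]`, via the image `θ(X⁰_k) ⊇ p^Nℂ` and the kernel statement = Fontaine's lemma on `A_max`.
[cite: FontaineOuyang2022, §6.1] [cite: FontaineAsterisque223III, Exp. III Th. 5.3.7] -/
theorem isTeichLog_pow_mul_of_bdR_lim_modFil_of_frobBmaxPlus_eq (hF : Function.Surjective (fontaineTheta (integerC F) p))
    (hpv : valuation F p < 1) {k : ℕ} (hk : 1 ≤ k) {x : BmaxPlus F p} (hx : frobBmaxPlus F p x = (p : BmaxPlus F p) * x)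
    {L : BDeRhamPlus (integerC F) p} {r : ℕ}
    (hL : (∀ N M : ℕ, N + r ≤ M → ∀ y : bmaxZero F p,
      AdicCompletion.evalₐ (Ideal.span {(p : bmaxZero F p)}) M (x) = Ideal.Quotient.mk _ y →
      ∃ (a : Ainf (p := p) F) (w : BDeRhamPlus (integerC F) p),
        (p : BDeRhamPlus (integerC F) p) ^ k *
            (L - algebraMap (Localization.Away (p : Ainf (p := p) F)) (BDeRhamPlus (integerC F) p)
              (y : Localization.Away (p : Ainf (p := p) F))) =
          ainfToBdR ((p : Ainf (p := p) F) ^ N * a) + xiBdR ^ k * w)) :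
    ∃ M : ℕ, IsTeichLog k ((p : BDeRhamPlus (integerC F) p) ^ M * L) := by
  -- (1) a Teichmüller logarithm with the right `θ`
  obtain ⟨N, L₁, ⟨x₁, hx₁, hL₁⟩, hθ₁⟩ :=
    exists_isTeichLog_thetaBdR_eq_pow_mul hpv hk ((thetaBmaxPlus F p x : integerC F) : CompletedAlgClosure F)
  -- (2) its `A_max`-lift
  obtain ⟨Λ, LΛ, L', rΛ, hφΛ, hLΛ, hpL', hL', hθΛ⟩ := exists_logSum_teichmuller x₁ hx₁ hk
  -- (3) `L' ≡ L₁ (mod ξ^k)`, hence `θ(L') = θ(L₁)`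
  have h3 : L' - L₁ ∈ Ideal.span {(xiBdR : BDeRhamPlus (integerC F) p) ^ k} := hL'.teichmuller_unique hL₁
  have hθ' : thetaBdR L' = thetaBdR L₁ := by
    have h := thetaBdR_eq_zero_of_mem_span_xiBdR_pow hk h3
    rwa [map_sub, sub_eq_zero] at h
  -- (4) `θ_max(p^{N+1} x − Λ) = 0`
  set D : BmaxPlus F p := (p : BmaxPlus F p) ^ (N + 1) * x - Λ with hD
  have hθD : thetaBmaxPlus F p D = 0 := by
    have e1 : ((thetaBmaxPlus F p Λ : integerC F) : CompletedAlgClosure F) =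
        (p : CompletedAlgClosure F) ^ (N + 1) * ((thetaBmaxPlus F p x : integerC F) : CompletedAlgClosure F) := by
      rw [← hθΛ, ← hpL', map_mul, map_natCast, hθ', hθ₁, pow_succ]; ring
    apply Subtype.ext
    rw [hD, map_sub, map_mul, map_pow, map_natCast, AddSubgroupClass.coe_sub, Subring.coe_mul, SubmonoidClass.coe_pow,
      coe_natCast_integerC, e1, sub_self, ZeroMemClass.coe_zero]
  have hφD : frobBmaxPlus F p D = (p : BmaxPlus F p) * D := by
    rw [hD, map_sub, map_mul, map_pow, map_natCast, hx, hφΛ]; ring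
  -- (5) Fontaine's lemma
  obtain ⟨lam, hlam⟩ := exists_sq_mul_eq_zpToAinf_mul_tBmax' hF hφD hθD
  -- (6) `p^{N+3} x = ι(p²)·Λ + ι(λ)·t` in `A_max`
  have h6 : ainfToBmaxPlus F p ((p : Ainf (p := p) F) ^ (N + 3)) * x =
      ainfToBmaxPlus F p ((p : Ainf (p := p) F) ^ 2) * Λ + ainfToBmaxPlus F p (zpToAinf lam) * tBmax := by
    rw [map_pow, map_natCast, map_pow, map_natCast, ← hlam, hD]; ring
  -- (7) limits of both sides
  have hlhs := bdR_lim_modFil_mul (bdR_lim_modFil_ainfToBmaxPlus ((p : Ainf (p := p) F) ^ (N + 3)) k) hL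
  obtain ⟨r₁, hr₁⟩ := hlhs
  obtain ⟨r₂, hr₂⟩ := bdR_lim_modFil_mul (bdR_lim_modFil_ainfToBmaxPlus ((p : Ainf (p := p) F) ^ 2) k) hLΛ
  obtain ⟨r₃, hr₃⟩ := bdR_lim_modFil_mul (bdR_lim_modFil_ainfToBmaxPlus (zpToAinf lam) k) (bdR_lim_modFil_tBmax (F := F) (p := p) k)
  have hrhs := bdR_lim_modFil_add hr₂ hr₃
  rw [← h6] at hrhs
  have h7 := sub_mem_span_xiBdR_pow_of_bdR_lim_modFil hr₁ hrhs
  -- (8) the right-hand side is a Teichmüller logarithm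
  have hT : IsTeichLog k (ainfToBdR ((p : Ainf (p := p) F) ^ 2) * LΛ + ainfToBdR (zpToAinf lam) * tBdR) := by
    have e : ainfToBdR ((p : Ainf (p := p) F) ^ 2) * LΛ = ((p ^ 3 : ℕ) : BDeRhamPlus (integerC F) p) * L' := by
      rw [map_pow, map_natCast, ← hpL', Nat.cast_pow, pow_succ]; ring
    rw [e, ← qpToBdR_coe]
    exact IsTeichLog.add (IsTeichLog.natCast_mul ⟨x₁, hx₁, hL'⟩ _) (isTeichLog_smul_tBdR k lam)
  refine ⟨N + 3, IsTeichLog.of_sub_mem hT ?_⟩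
  rw [map_pow, map_natCast] at h7
  exact h7

/-! ### The kernel case in `B_dR⁺`-currency: eigenvectors in `ker θ` map to `ℚ_p·t` -/

set_option maxHeartbeats 3200000 in
set_option synthInstance.maxHeartbeats 400000 in
/-- ★★ **Eigenvectors in `ker θ` map to `ℚ_p·t` modulo `Fil^k`** (the Legendre-relation input of brick B8): if `φ(x) = p·x`, `θ(x) = 0` in
`A_max` and `L` is a comparison limit of `x` modulo `Fil^k`, then `p²·L − λ·t ∈ ξ^k B_dR⁺` for some `λ ∈ ℤ_p` (Fontaine's lemma
`p²x = ι(λ)t` transported by the comparison, which is a ring map sending `t ↦ t`). [cite: FontaineAsterisque223III, Exp. III Th. 5.3.7]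
[cite: Colmez1998Annals, §III.3] -/
theorem exists_sq_mul_sub_smul_tBdR_mem_of_bdR_lim_modFil (hF : Function.Surjective (fontaineTheta (integerC F) p))
    {k : ℕ} {x : BmaxPlus F p} (hx : frobBmaxPlus F p x = (p : BmaxPlus F p) * x) (hθ : thetaBmaxPlus F p x = 0)
    {L : BDeRhamPlus (integerC F) p} {r : ℕ}
    (hL : (∀ N M : ℕ, N + r ≤ M → ∀ y : bmaxZero F p,
      AdicCompletion.evalₐ (Ideal.span {(p : bmaxZero F p)}) M (x) = Ideal.Quotient.mk _ y →
      ∃ (a : Ainf (p := p) F) (w : BDeRhamPlus (integerC F) p),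
        (p : BDeRhamPlus (integerC F) p) ^ k *
            (L - algebraMap (Localization.Away (p : Ainf (p := p) F)) (BDeRhamPlus (integerC F) p)
              (y : Localization.Away (p : Ainf (p := p) F))) =
          ainfToBdR ((p : Ainf (p := p) F) ^ N * a) + xiBdR ^ k * w)) :
    ∃ lam : ℤ_[p], (p : BDeRhamPlus (integerC F) p) ^ 2 * L - qpToBdR (lam : ℚ_[p]) * tBdR ∈
      Ideal.span {(xiBdR : BDeRhamPlus (integerC F) p) ^ k} := by
  obtain ⟨lam, hlam⟩ := exists_sq_mul_eq_zpToAinf_mul_tBmax' hF hx hθ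
  refine ⟨lam, ?_⟩
  have h1 : ainfToBmaxPlus F p ((p : Ainf (p := p) F) ^ 2) * x = ainfToBmaxPlus F p (zpToAinf lam) * tBmax := by
    rw [map_pow, map_natCast, hlam]
  obtain ⟨r₁, hr₁⟩ := bdR_lim_modFil_mul (bdR_lim_modFil_ainfToBmaxPlus ((p : Ainf (p := p) F) ^ 2) k) hL
  obtain ⟨r₂, hr₂⟩ := bdR_lim_modFil_mul (bdR_lim_modFil_ainfToBmaxPlus (zpToAinf lam) k) (bdR_lim_modFil_tBmax (F := F) (p := p) k)
  rw [← h1] at hr₂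
  have h2 := sub_mem_span_xiBdR_pow_of_bdR_lim_modFil hr₁ hr₂
  rwa [map_pow, map_natCast, ← qpToBdR_coe] at h2

end Literature.NumberTheory.PAdicHodge


end
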